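import Summits.BirchSwinnertonDyer.BirchSwinnertonDyer.Theorems.PrintX11aLeafOfChildren
import Summits.BirchSwinnertonDyer.BirchSwinnertonDyer.Theorems.PrintX11aLowerHalfPartnerFactsOfFourOfMazur
import HarnessLib

/-!
# Crux `X11aLowerHalf` (item stmt-BirchSwinnertonDyer-19064; routes `PrintX11a` rank 2 ∕ `ErratumRoadFive` rank 5) and the leaf
# `WAllCornerX11a` from the children of line «birth» with the partner-road bundle RE-CUT TO FOUR named facts — the r11 children glue
# (width seat bsd-line-er5-p2 = -w3, p = 3 binder, gen 7; `--supports stmt-BirchSwinnertonDyer-19064` helper)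

HONEST FRAMING.  Five composition theorems; no definition, no named fact minted, no `sorry`.  Every theorem is CONDITIONAL and
closes NOTHING: each hypothesis is DISPLAYED — twenty-five statement-only named published facts (never proved; Skinner–Urban 3.6.4
(ram) rational carries the cell's counting flag `SU14-12.3.6-mu@nonsplit@3`; the Emerton–Pollack–Weston odd-prime instances and
Yan–Zhu Thm. 4.9 carry the disclosure tokens `EPW06@3-Hida-control` ∕ `YZ26@3-BF-ERL-Ohta`), K2's OPEN item 19948, Greenberg's
analytic `μ = 0` on the deep SURJECTIVE X11a pairs at `p ≥ 5` (OPEN) and the lower half on the très-ramifié off-Kodaira deep X11a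
pairs at `3` (THE OPEN CORE).  The gate records a `conditional-result`; the leaf `WAllCornerX11a` is an OPEN `@[conjecture]` and is
NOT proved; BSD is proved for no curve and no class; PARTITION 0.  beyond-print theorem: no.

## What and why

Line «birth» r10 (`Cruxes/X11aLowerHalf/Lines/birth.lean`, sha16 cb3a79fc, lead bsd-line-x11a-p1 gen 3) registers SEVEN stubs; its
p = 3 partner-road bundle `stub_partnerFactsLower` displays FIVE named facts — Emerton–Pollack–Weston Cor. 5.1.4 (good ⟶ mult, odd
`p`), Yan–Zhu 2026 Thm. 4.9 (rational), the period unit at the good prime `3` (`realPeriodRat_eq_unit_mul_plusPeriod_three`),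
Emerton–Pollack–Weston Thm. 1 alg ∕ an (mult ⟶ good, odd `p`).  The third is a THEOREM of the tree GIVEN Mazur 1978 Cor. 4.1
(`mazur_not_dvd_maninConstant_of_odd`), which is ALREADY conjunct 9 of the shared nine-fact stub `stub_nineFactsOddGS`:
`SkinnerUrban2014.realPeriodRat_eq_unit_mul_plusPeriod_three_of_mazur` (`PAdicUnitPeriodRatioProofs.lean`), packaged for this line by
the INPUTS desk's `PrintX11a.InputsPartnerFacts.partnerFactsLower_of_four_of_mazur` (p637825, `PrintX11aLowerHalfPartnerFactsOfFourOfMazur.lean`).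
This file composes that door with the lead's r10 glues, so that a successor lead can register r11 = r10 with the partner bundle re-cut
to FOUR conjuncts (`stub_fourPartnerFactsLower`; r10's five-conjunct text becomes a THEOREM in the skeleton, composition byte-identical)
and the planner's children booking needs ONE FEWER named input:

* `Birth.partnerFactsLower_of_fourPartnerFacts_of_nineFactsOddGS : (four) → (U3's nine) → (r10's five)`;
* `Birth.x11aLowerHalf_of_children_r11 : (U3's nine) → (eleven) → (SU 3.6.4 (ram)) → (FOUR partner facts) →
     Theses.ErratumRoadFive.NonSurjCornerTwinMuAn → (stub_muAnSurjDeepFive) → (stub_lowerTresRamifieThree) → Theses.PrintX11a.X11aLowerHalf`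
  (:= `Birth.x11aLowerHalf_of_children_r10`, p635707, fed the rebuilt five) and its `ErratumRoadFive` spelling;
* `PrintX11aLeaf.cruxes_of_children_r11` ∕ `PrintX11aLeaf.wAllCornerX11a_of_children_r11` — the lead's leaf displays (p637267) with the
  same re-cut: the route's three open cruxes + parent, and the leaf `WAllCornerX11a`, from the r11 children (+ Wuthrich Prop. 21).

Counting (INPUTS-LIST-2 ADD-15 §B convention): distinct named facts displayed on 19064's line 26 → 25 (nine + eleven + four + one);
on the leaf display 27 → 26 (… + Wuthrich Prop. 21).  Closing recipe once children are filed with these exact statements (19948 exists):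
`theorem X11aLowerHalf_holds : Theses.PrintX11a.X11aLowerHalf := Birth.x11aLowerHalf_of_children_r11 C_nine C_eleven C_ram C_facts4 C_19948 C_surj C_tres`
(`--workitem stmt-BirchSwinnertonDyer-19064`).  Nothing here is new mathematics; no summit statement is proved by this seat.

References: [Mazur1978] Cor. 4.1; [GreenbergVatsal2000] §3 Remark (3.4); [SkinnerUrban2014] §3.6.7 (p. 45), Thm. 3.6.4 (p. 43);
[EmertonPollackWeston2006] Thm. 1, Thm. 3.1.1, Thm. 5.1.3, Cor. 5.1.4; [YanZhu2024MainConjNonCM] Thm. 4.9; [Wan2015] Thm. 4;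
[Kato2004Asterisque] Thm. 12.4, §17.13; [SteinWuthrich2013] Thm. 6.1; [Wuthrich2014] Prop. 21; [GreenbergLNM1716] Conj. 1.11;
[Miller2011LMS] Def. 1.1; cell files `Cruxes/X11aLowerHalf/Lines/birth.lean` (r10), `LEAD-g3-VERDICT.md`, INPUTS-LIST-2-ADDENDUM-15 §B (T21).
-/

set_option autoImplicit false
set_option linter.dupNamespace false -- the directory name repeats the summit name (sibling precedent)

noncomputable section

open scoped Classical

open WeierstrassCurve IsDedekindDomain Rat.HeightOneSpectrum
  Literature.NumberTheory.EllipticCurves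
  Literature.NumberTheory.EllipticCurves.ModularForms
  Literature.NumberTheory.EllipticCurves.Rank1Residual
  Literature.NumberTheory.EllipticCurves.Rank1Residual.Typed
  Literature.NumberTheory.EllipticCurves.Wuthrich2014
  Literature.NumberTheory.EllipticCurves.SteinWuthrich2013
  Literature.NumberTheory.EllipticCurves.Greenberg1999
  Literature.NumberTheory.EllipticCurves.Kato2004
  Literature.NumberTheory.EllipticCurves.GreenbergVatsal2000
  Literature.NumberTheory.EllipticCurves.EmertonPollackWeston2006
  Literature.NumberTheory.EllipticCurves.SkinnerUrban2014
  Literature.NumberTheory.EllipticCurves.BalakrishnanEtAl2019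
  Summit.BirchSwinnertonDyer.Rank1Residual

namespace Summit.BirchSwinnertonDyer.BirchSwinnertonDyer.Theorems.Birth

/-- **r10's five-conjunct partner-road bundle `stub_partnerFactsLower` from the FOUR printed partner facts and the shared nine-fact
stub** (its conjunct 9 is Mazur 1978 Cor. 4.1): the period unit at the good prime `3` under (irr) is the tree's theorem
`SkinnerUrban2014.realPeriodRat_eq_unit_mul_plusPeriod_three_of_mazur`, packaged as `InputsPartnerFacts.partnerFactsLower_of_four_of_mazur`
(p637825).  Pure glue; CONDITIONAL on the named facts; closes nothing; BSD is not proved.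
[cite: Mazur1978, Cor. 4.1] [cite: GreenbergVatsal2000, §3 Remark (3.4)] [cite: SkinnerUrban2014, §3.6.7 (p. 45)]
[cite: EmertonPollackWeston2006, Thm. 1, Cor. 5.1.4 (arXiv:math/0404484 pp. 2, 30)] [cite: YanZhu2024MainConjNonCM, Thm. 4.9] -/
theorem partnerFactsLower_of_fourPartnerFacts_of_nineFactsOddGS
    (hQ4 : cor514_transfer_of_goodOrdinary_odd ∧ YanZhu2026.thm49_charIdeal_eq_padicLFunction ∧
      thm1_muAlg_transfer_goodOrdinary_of_mult_odd ∧ thm1_muAn_transfer_goodOrdinary_of_mult_odd)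
    (h9 : thm61_splitMultiplicative ∧ thm61_nonsplitMultiplicative ∧
      (∀ (W : WeierstrassCurve ℚ) [W.IsElliptic] [W.IsGloballyMinimal] (p : ℕ) [Fact p.Prime],
        p ≠ 2 → greenberg_stevens (W := W) (p := p)) ∧
      Kato2004.thm12_4 ∧ exists_isNewformOf ∧
      Kato2004.exists_multDivisibilityInputs_nonsplit_contra ∧
      Kato2004.exists_multDivisibilityInputs_split_contra ∧
      Kato2004.exists_multDivisibilityInputs_fine_contra ∧ mazur_not_dvd_maninConstant_of_odd) :
    cor514_transfer_of_goodOrdinary_odd ∧ YanZhu2026.thm49_charIdeal_eq_padicLFunction ∧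
      realPeriodRat_eq_unit_mul_plusPeriod_three ∧ thm1_muAlg_transfer_goodOrdinary_of_mult_odd ∧
      thm1_muAn_transfer_goodOrdinary_of_mult_odd :=
  Summit.BirchSwinnertonDyer.BirchSwinnertonDyer.Theorems.PrintX11a.InputsPartnerFacts.partnerFactsLower_of_four_of_mazur
    hQ4 h9.2.2.2.2.2.2.2.2

/-- **Crux L BY NAME from the seven children of line «birth» r11 — r10 with the partner-road bundle RE-CUT to FOUR named facts**
(Emerton–Pollack–Weston Cor. 5.1.4 and Thm. 1 alg ∕ an at an odd prime [token EPW06@3-Hida-control], Yan–Zhu 2026 Thm. 4.9 rational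
[token YZ26@3-BF-ERL-Ohta]); the period unit at `3` is supplied by Mazur Cor. 4.1 = conjunct 9 of `h9` through
`partnerFactsLower_of_fourPartnerFacts_of_nineFactsOddGS`, then the lead's r10 glue `x11aLowerHalf_of_children_r10` (p635707).
CONDITIONAL (the gate records a `conditional-result`; closes nothing; BSD is proved for no curve and no class).  Hypotheses: `h9` =
`stub_nineFactsOddGS` (= crux U3's `FineMu.stub_nineFactsOddGS`, shared), `h11` = `stub_elevenFactsLower`, `hR` = `stub_suRamFactLower`
[flag SU14-12.3.6@3], `hQ4` = the FOUR partner facts (the r11 stub `stub_fourPartnerFactsLower`), `h48` = `stub_twinMuAn` = K2's item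
19948, `hS` = `stub_muAnSurjDeepFive` (OPEN), `hT` = `stub_lowerTresRamifieThree` (OPEN CORE) — all VERBATIM registered texts of r10
except `hQ4`.  Closing recipe: `X11aLowerHalf_holds := x11aLowerHalf_of_children_r11 C_nine C_eleven C_ram C_facts4 C_19948 C_surj C_tres`.
[cite: EmertonPollackWeston2006, Thm. 1, Cor. 5.1.4 (arXiv:math/0404484 pp. 2, 30)] [cite: Mazur1978, Cor. 4.1]
[cite: SkinnerUrban2014, Thm. 3.6.4 (p. 43)] [cite: GreenbergLNM1716, §1 Conj. 1.11 (p. 61)] [cite: Miller2011LMS, Def. 1.1 (arXiv:1010.2431 p. 3)] -/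
theorem x11aLowerHalf_of_children_r11
    (h9 : thm61_splitMultiplicative ∧ thm61_nonsplitMultiplicative ∧
      (∀ (W : WeierstrassCurve ℚ) [W.IsElliptic] [W.IsGloballyMinimal] (p : ℕ) [Fact p.Prime],
        p ≠ 2 → greenberg_stevens (W := W) (p := p)) ∧
      Kato2004.thm12_4 ∧ exists_isNewformOf ∧
      Kato2004.exists_multDivisibilityInputs_nonsplit_contra ∧
      Kato2004.exists_multDivisibilityInputs_split_contra ∧
      Kato2004.exists_multDivisibilityInputs_fine_contra ∧ mazur_not_dvd_maninConstant_of_odd)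
    (h11 : thm311_cotorsion_weightK_member_ofLevel_odd ∧ thm1_muAlg_of_weightK_member_ofLevel_odd ∧
      Wan2015.thm4_rational_weightK_member_of_bdd_ofLevel_irred ∧
      thm513_transfer_from_weightK_member_of_bdd_ofLevel_odd ∧
      DeligneSerre1974.thm61_exists_adicGaloisRep ∧ Hida2000_thm326_ordinary ∧
      kato_charIdeal_dvd_multiplicative_of_surjective ∧
      rank_eq_analyticRank_of_analyticRank_le_one ∧
      thm12_not_le_normalizer_splitCartan ∧
      ribet1990_levelLowering_gamma0_newform_at_three_additiveDrop ∧
      carayolLivne_additivePrime_dvd_level_of_congruent_newform)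
    (hR : thm364_rational_weightK_member_of_bdd_ofLevel_ram)
    (hQ4 : cor514_transfer_of_goodOrdinary_odd ∧ YanZhu2026.thm49_charIdeal_eq_padicLFunction ∧
      thm1_muAlg_transfer_goodOrdinary_of_mult_odd ∧ thm1_muAn_transfer_goodOrdinary_of_mult_odd)
    (h48 : Summit.BirchSwinnertonDyer.BirchSwinnertonDyer.Theses.ErratumRoadFive.NonSurjCornerTwinMuAn)
    (hS : ∀ (W : WeierstrassCurve ℚ) [W.IsElliptic] [W.IsGloballyMinimal] (p : ℕ) [Fact p.Prime],
      ClassX11a W p → 5 ≤ p → Surj W p → ¬ X11a.ShaAnUnit W p → X11a.MuAnZeroAt W p)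
    (hT : ∀ (W : WeierstrassCurve ℚ) [W.IsElliptic] [W.IsGloballyMinimal] (p : ℕ) [Fact p.Prime],
      ClassX11a W p → p = 3 → ¬ X11a.ShaAnUnit W p →
      ¬ (Surj W p ∧ ∃ v : HeightOneSpectrum ℤ, W.HasAdditiveReductionAt v ∧
          3 ∣ (W.kodairaSymbolAt v).componentGroupOrder ∧ ¬ natGenerator v ^ 3 ∣ W.conductorNorm ℤ) →
      ¬ p ∣ padicValInt p W.minimalDiscriminantInt → MissingLowerBoundAt W p) :
    Summit.BirchSwinnertonDyer.BirchSwinnertonDyer.Theses.PrintX11a.X11aLowerHalf :=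
  x11aLowerHalf_of_children_r10 h9 h11 hR (partnerFactsLower_of_fourPartnerFacts_of_nineFactsOddGS hQ4 h9) h48 hS hT

/-- The `ErratumRoadFive` spelling of the seven-children glue r11 (one statement under two route names, `Iff.rfl`).
[cite: Miller2011LMS, Def. 1.1 (arXiv:1010.2431 p. 3)] [cite: Mazur1978, Cor. 4.1] -/
theorem x11aLowerHalf_erratumRoadFive_of_children_r11
    (h9 : thm61_splitMultiplicative ∧ thm61_nonsplitMultiplicative ∧
      (∀ (W : WeierstrassCurve ℚ) [W.IsElliptic] [W.IsGloballyMinimal] (p : ℕ) [Fact p.Prime],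
        p ≠ 2 → greenberg_stevens (W := W) (p := p)) ∧
      Kato2004.thm12_4 ∧ exists_isNewformOf ∧
      Kato2004.exists_multDivisibilityInputs_nonsplit_contra ∧
      Kato2004.exists_multDivisibilityInputs_split_contra ∧
      Kato2004.exists_multDivisibilityInputs_fine_contra ∧ mazur_not_dvd_maninConstant_of_odd)
    (h11 : thm311_cotorsion_weightK_member_ofLevel_odd ∧ thm1_muAlg_of_weightK_member_ofLevel_odd ∧
      Wan2015.thm4_rational_weightK_member_of_bdd_ofLevel_irred ∧
      thm513_transfer_from_weightK_member_of_bdd_ofLevel_odd ∧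
      DeligneSerre1974.thm61_exists_adicGaloisRep ∧ Hida2000_thm326_ordinary ∧
      kato_charIdeal_dvd_multiplicative_of_surjective ∧
      rank_eq_analyticRank_of_analyticRank_le_one ∧
      thm12_not_le_normalizer_splitCartan ∧
      ribet1990_levelLowering_gamma0_newform_at_three_additiveDrop ∧
      carayolLivne_additivePrime_dvd_level_of_congruent_newform)
    (hR : thm364_rational_weightK_member_of_bdd_ofLevel_ram)
    (hQ4 : cor514_transfer_of_goodOrdinary_odd ∧ YanZhu2026.thm49_charIdeal_eq_padicLFunction ∧
      thm1_muAlg_transfer_goodOrdinary_of_mult_odd ∧ thm1_muAn_transfer_goodOrdinary_of_mult_odd)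
    (h48 : Summit.BirchSwinnertonDyer.BirchSwinnertonDyer.Theses.ErratumRoadFive.NonSurjCornerTwinMuAn)
    (hS : ∀ (W : WeierstrassCurve ℚ) [W.IsElliptic] [W.IsGloballyMinimal] (p : ℕ) [Fact p.Prime],
      ClassX11a W p → 5 ≤ p → Surj W p → ¬ X11a.ShaAnUnit W p → X11a.MuAnZeroAt W p)
    (hT : ∀ (W : WeierstrassCurve ℚ) [W.IsElliptic] [W.IsGloballyMinimal] (p : ℕ) [Fact p.Prime],
      ClassX11a W p → p = 3 → ¬ X11a.ShaAnUnit W p →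
      ¬ (Surj W p ∧ ∃ v : HeightOneSpectrum ℤ, W.HasAdditiveReductionAt v ∧
          3 ∣ (W.kodairaSymbolAt v).componentGroupOrder ∧ ¬ natGenerator v ^ 3 ∣ W.conductorNorm ℤ) →
      ¬ p ∣ padicValInt p W.minimalDiscriminantInt → MissingLowerBoundAt W p) :
    Summit.BirchSwinnertonDyer.BirchSwinnertonDyer.Theses.ErratumRoadFive.X11aLowerHalf :=
  x11aLowerHalf_of_children_r11 h9 h11 hR hQ4 h48 hS hT

end Summit.BirchSwinnertonDyer.BirchSwinnertonDyer.Theorems.Birth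

namespace Summit.BirchSwinnertonDyer.BirchSwinnertonDyer.Theorems.PrintX11aLeaf

/-- **Route `PrintX11a`'s three open cruxes — L (19064), U3 (20613), U5 (20614) — and the parent 20406, BY NAME, from the seven
children of line «birth» r11** (= the lead's `cruxes_of_children_r10`, p637267, with the partner bundle re-cut to FOUR facts; the
period unit at `3` from Mazur Cor. 4.1 ∈ `h9`).  CONDITIONAL; closes nothing; BSD is proved for no curve.
[cite: GreenbergLNM1716, §1 Conj. 1.11 (p. 61)] [cite: Kato2004Asterisque, Thm. 12.4 (p. 221), §17.13 (pp. 279–280)]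
[cite: SteinWuthrich2013, Thm. 6.1 (p. 20)] [cite: BalakrishnanEtAl2019, §1 Thm. 1.2] [cite: Mazur1978, Cor. 4.1] -/
theorem cruxes_of_children_r11
    (h9 : thm61_splitMultiplicative ∧ thm61_nonsplitMultiplicative ∧
      (∀ (W : WeierstrassCurve ℚ) [W.IsElliptic] [W.IsGloballyMinimal] (p : ℕ) [Fact p.Prime],
        p ≠ 2 → greenberg_stevens (W := W) (p := p)) ∧
      Kato2004.thm12_4 ∧ exists_isNewformOf ∧
      Kato2004.exists_multDivisibilityInputs_nonsplit_contra ∧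
      Kato2004.exists_multDivisibilityInputs_split_contra ∧
      Kato2004.exists_multDivisibilityInputs_fine_contra ∧ mazur_not_dvd_maninConstant_of_odd)
    (h11 : thm311_cotorsion_weightK_member_ofLevel_odd ∧ thm1_muAlg_of_weightK_member_ofLevel_odd ∧
      Wan2015.thm4_rational_weightK_member_of_bdd_ofLevel_irred ∧
      thm513_transfer_from_weightK_member_of_bdd_ofLevel_odd ∧
      DeligneSerre1974.thm61_exists_adicGaloisRep ∧ Hida2000_thm326_ordinary ∧
      kato_charIdeal_dvd_multiplicative_of_surjective ∧
      rank_eq_analyticRank_of_analyticRank_le_one ∧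
      thm12_not_le_normalizer_splitCartan ∧
      ribet1990_levelLowering_gamma0_newform_at_three_additiveDrop ∧
      carayolLivne_additivePrime_dvd_level_of_congruent_newform)
    (hR : thm364_rational_weightK_member_of_bdd_ofLevel_ram)
    (hQ4 : cor514_transfer_of_goodOrdinary_odd ∧ YanZhu2026.thm49_charIdeal_eq_padicLFunction ∧
      thm1_muAlg_transfer_goodOrdinary_of_mult_odd ∧ thm1_muAn_transfer_goodOrdinary_of_mult_odd)
    (h48 : Summit.BirchSwinnertonDyer.BirchSwinnertonDyer.Theses.ErratumRoadFive.NonSurjCornerTwinMuAn)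
    (hS : ∀ (W : WeierstrassCurve ℚ) [W.IsElliptic] [W.IsGloballyMinimal] (p : ℕ) [Fact p.Prime],
      ClassX11a W p → 5 ≤ p → Surj W p → ¬ X11a.ShaAnUnit W p → X11a.MuAnZeroAt W p)
    (hT : ∀ (W : WeierstrassCurve ℚ) [W.IsElliptic] [W.IsGloballyMinimal] (p : ℕ) [Fact p.Prime],
      ClassX11a W p → p = 3 → ¬ X11a.ShaAnUnit W p →
      ¬ (Surj W p ∧ ∃ v : HeightOneSpectrum ℤ, W.HasAdditiveReductionAt v ∧
          3 ∣ (W.kodairaSymbolAt v).componentGroupOrder ∧ ¬ natGenerator v ^ 3 ∣ W.conductorNorm ℤ) →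
      ¬ p ∣ padicValInt p W.minimalDiscriminantInt → MissingLowerBoundAt W p) :
    Summit.BirchSwinnertonDyer.BirchSwinnertonDyer.Theses.PrintX11a.X11aLowerHalf ∧
      Summit.BirchSwinnertonDyer.BirchSwinnertonDyer.Theses.PrintX11a.UpperNonSurjThree ∧
      Summit.BirchSwinnertonDyer.BirchSwinnertonDyer.Theses.PrintX11a.UpperNonSurjFive ∧
      Summit.BirchSwinnertonDyer.BirchSwinnertonDyer.Theses.PrintX11a.X11aNonSurjEulerHalf :=
  cruxes_of_children_r10 h9 h11 hR (Birth.partnerFactsLower_of_fourPartnerFacts_of_nineFactsOddGS hQ4 h9) h48 hS hT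

/-- **The registered leaf `WAllCornerX11a` (rung W-ALL ∕ 11) DISPLAYED modulo the seven children of line «birth» r11 and Wuthrich
2014 Prop. 21** (= the lead's `wAllCornerX11a_of_children_r10`, p637267, with the partner bundle re-cut to FOUR facts): in the kernel the
class theorem of leaf X11a holds MODULO twenty-six named published facts (one flagged SU14-12.3.6@3, the EPW ∕ Yan–Zhu instances with @3
tokens), K2's item 19948 and two OPEN statements (`hS`, `hT`).  CONDITIONAL: the conclusion is an OPEN `@[conjecture]` leaf and is NOT
proved here; the gate records a `conditional-result`; PARTITION 0; BSD is proved for no class.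
[cite: Miller2011LMS, Def. 1.1 (arXiv:1010.2431 p. 3)] [cite: Wuthrich2014, Prop. 21 (p. 400)] [cite: Mazur1978, Cor. 4.1]
[cite: GreenbergLNM1716, §1 Conj. 1.11 (p. 61)] [cite: SkinnerUrban2014, Thm. 3.6.4 (p. 43)] -/
theorem wAllCornerX11a_of_children_r11
    (h9 : thm61_splitMultiplicative ∧ thm61_nonsplitMultiplicative ∧
      (∀ (W : WeierstrassCurve ℚ) [W.IsElliptic] [W.IsGloballyMinimal] (p : ℕ) [Fact p.Prime],
        p ≠ 2 → greenberg_stevens (W := W) (p := p)) ∧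
      Kato2004.thm12_4 ∧ exists_isNewformOf ∧
      Kato2004.exists_multDivisibilityInputs_nonsplit_contra ∧
      Kato2004.exists_multDivisibilityInputs_split_contra ∧
      Kato2004.exists_multDivisibilityInputs_fine_contra ∧ mazur_not_dvd_maninConstant_of_odd)
    (h11 : thm311_cotorsion_weightK_member_ofLevel_odd ∧ thm1_muAlg_of_weightK_member_ofLevel_odd ∧
      Wan2015.thm4_rational_weightK_member_of_bdd_ofLevel_irred ∧
      thm513_transfer_from_weightK_member_of_bdd_ofLevel_odd ∧
      DeligneSerre1974.thm61_exists_adicGaloisRep ∧ Hida2000_thm326_ordinary ∧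
      kato_charIdeal_dvd_multiplicative_of_surjective ∧
      rank_eq_analyticRank_of_analyticRank_le_one ∧
      thm12_not_le_normalizer_splitCartan ∧
      ribet1990_levelLowering_gamma0_newform_at_three_additiveDrop ∧
      carayolLivne_additivePrime_dvd_level_of_congruent_newform)
    (hR : thm364_rational_weightK_member_of_bdd_ofLevel_ram)
    (hQ4 : cor514_transfer_of_goodOrdinary_odd ∧ YanZhu2026.thm49_charIdeal_eq_padicLFunction ∧
      thm1_muAlg_transfer_goodOrdinary_of_mult_odd ∧ thm1_muAn_transfer_goodOrdinary_of_mult_odd)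
    (h48 : Summit.BirchSwinnertonDyer.BirchSwinnertonDyer.Theses.ErratumRoadFive.NonSurjCornerTwinMuAn)
    (hS : ∀ (W : WeierstrassCurve ℚ) [W.IsElliptic] [W.IsGloballyMinimal] (p : ℕ) [Fact p.Prime],
      ClassX11a W p → 5 ≤ p → Surj W p → ¬ X11a.ShaAnUnit W p → X11a.MuAnZeroAt W p)
    (hT : ∀ (W : WeierstrassCurve ℚ) [W.IsElliptic] [W.IsGloballyMinimal] (p : ℕ) [Fact p.Prime],
      ClassX11a W p → p = 3 → ¬ X11a.ShaAnUnit W p →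
      ¬ (Surj W p ∧ ∃ v : HeightOneSpectrum ℤ, W.HasAdditiveReductionAt v ∧
          3 ∣ (W.kodairaSymbolAt v).componentGroupOrder ∧ ¬ natGenerator v ^ 3 ∣ W.conductorNorm ℤ) →
      ¬ p ∣ padicValInt p W.minimalDiscriminantInt → MissingLowerBoundAt W p)
    (hWu : Wuthrich2014.sha_dvd_analyticSha) :
    Summit.BirchSwinnertonDyer.WAllCornerX11a := by
  -- as in the lead's `wAllCornerX11a_of_children_r10`: the route's deciding theorem on the two halves and ⟨Prop. 21, GZK, modularity⟩
  obtain ⟨hL, -, -, hE⟩ := cruxes_of_children_r11 h9 h11 hR hQ4 h48 hS hT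
  exact Summit.BirchSwinnertonDyer.BirchSwinnertonDyer.Theses.PrintX11a.closes hL hE ⟨hWu, h11.2.2.2.2.2.2.2.1, h9.2.2.2.2.1⟩

end Summit.BirchSwinnertonDyer.BirchSwinnertonDyer.Theorems.PrintX11aLeaf

end
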